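import Summits.BirchSwinnertonDyer.BirchSwinnertonDyer.Theorems.PublishedInputsGreenbergLocalSurjectivityAtPCoinv
import Summits.BirchSwinnertonDyer.BirchSwinnertonDyer.Theorems.PublishedInputsGreenbergLayerQuotientHom
import HarnessLib

set_option linter.dupNamespace false -- `…BirchSwinnertonDyer.BirchSwinnertonDyer…` is the cell's nested layout (D-0017)
set_option autoImplicit false

/-!
# Greenberg LNM 1716 Lemma 3.4 at the layers `n ≥ 1`, brick 11: `(E(K_{∞,η}) ⊗ ℚ_p/ℤ_p)_{Γ_{v_n}} = 0` at the LAYER `n`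
# (element-wise: `p^j a = (g^{pⁿ} − 1) m + p^{k+j} R + t`), from `H²(H_n, Ê[p^∞]) = 0` and Coates–Greenberg

Seat `bsd-inputs-k4-p1` (gen 6; LADDER-BSD D-0154 KEY (147)(f) «prove the printed input», row 1 K4 INPUTS; Greenberg
1999), `--supports stmt-BirchSwinnertonDyer-20309`. THEOREMS ONLY (no definition, no named fact, no `sorry`).

Greenberg, LNM 1716 (1999), §4 p. 108 and §2 pp. 70–75: the coinvariants of `E(K_{∞,η}) ⊗ ℚ_p/ℤ_p` under
`Γ_{v_n} = Gal((F_∞)_η/(F_n)_{v_n})` vanish ("`Gal((F_∞)_η/(F_n)_{v_n})` has `p`-cohomological dimension `1`, looking at the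
maps `λ_v`"). Gen 4 of this seat proved the layer `0` (`InputsGreenbergLocalAtP.coinvInput_of_formalH2_of_coatesGreenberg`,
generator `g` of `Gal(K_{∞,η}/K_v)`); gen 5 used it in the dévissage of Lemma 3.4 at `n = 0`. This file is the layer-`n`
form — the generator is `g^{pⁿ}`, the group is the open subgroup `H_n = κE⁻¹(pⁿℤ_p) ≤ Γ_{K_v}` and the Hochschild–Serre
edge theorem (`exists_conjMap_sub_eq_of_resSubgroup_two_injective`) is applied to the continuous surjection
`κ_n = p^{-n}κ : H_n ↠ ℤ_p` of brick 10 with the vanishing `H²(H_n, C) = 0` of brick 9: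

* `coinvInput_layer_of_mem_ker` — the core (`a ∈ E₁ ∩ E(K̄_v)^N`): `p^j a = (g^{pⁿ} m − m) + p^{k+j} R` with `m, R`
  fixed by `N`.
* `coinvInput_layer_of_formalH2_of_coatesGreenberg` — for every `N`-fixed `a` and every `k`:
  `p^j a = (g^{pⁿ} m − m) + p^{k+j} R + t`, `t` `p`-power torsion (gen 4's prime-to-`p` / `p`-power bookkeeping).

HONEST FRAMING: local TOOL theorems with displayed hypotheses; closes no item; no summit statement is proved; BSD is not
proved by any of this.

References: [GreenbergLNM1716] §2 Props. 2.1–2.4 (pp. 70–75), §4 p. 108; [CoatesGreenberg1996] Cor. 3.2, Prop. 4.3;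
[NeukirchSchmidtWingberg2008] (2.4.1); [SerreLocalFields1979] XIII §1.
-/

noncomputable section

open scoped Classical NNReal

universe u

namespace Summit.BirchSwinnertonDyer.BirchSwinnertonDyer.Theorems.InputsGreenbergLemma34Layer

open CategoryTheory NumberField IsDedekindDomain Field _root_.TopRep _root_.ContinuousCohomology WeierstrassCurve
  Literature.NumberTheory.GaloisRepresentations Literature.NumberTheory.EllipticCurves.ZpExtension
  Summit.BirchSwinnertonDyer.BirchSwinnertonDyer.Theorems.InputsGreenbergLocalAtP
open Literature.NumberTheory.EllipticCurves hiding subgroupIncl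

variable {K : Type u} [Field K] [NumberField K] (v : HeightOneSpectrum (𝓞 K)) (W : WeierstrassCurve K)
  {p : ℕ} [hp : Fact p.Prime]

set_option maxHeartbeats 3200000 in
/-- **(H²) at the layer `n` for `a ∈ E(K̄_v)^N ∩ E₁`, through the maps `λ_v`.** Setting of gen 4's `coinvInput_of_mem_ker`
(`κE` a `ℤ_p`-extension of `K_v` with kernel `N` and topological generator `g`; `red₀` with stable, `p`-divisible kernel
`E₁`; `C = E₁ ∩ E(K̄_v)[p^∞]` carried by `ρ`; the Coates–Greenberg vanishing `hCG` on `N`), with the vanishing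
**`H²(H_n, C) = 0`** for the open subgroup `H_n = κE⁻¹(pⁿℤ_p)` (`hH2`, brick 9). Then for every `a ∈ E₁` fixed by `N` and
every `k` there are `j` and `N`-fixed `m, R` with `p^j a = (g^{pⁿ} m − m) + p^{k+j} R`. Proof: the Kummer cocycle of `a` in
`H¹(N, C)` is `g^{pⁿ}·ψ − ψ` up to a coboundary by the Hochschild–Serre edge on `κ_n : H_n ↠ ℤ_p` (brick 10,
`cd_p(H_n/N) ≤ 1`); `ψ = ∂e` by Coates–Greenberg; unwind and clear denominators as in gen 4.
[cite: GreenbergLNM1716, §2 Props. 2.2–2.4 (pp. 72–75) and §4 p. 108] [cite: CoatesGreenberg1996, Cor. 3.2 and Prop. 4.3]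
[cite: NeukirchSchmidtWingberg2008, (2.4.1)] -/
theorem coinvInput_layer_of_mem_ker (κE : ZpExtension (v.adicCompletion K) p)
    {g : absoluteGaloisGroup (v.adicCompletion K)} (hγ : κE.IsTopGenerator g) (n : ℕ)
    {B : Type*} [AddCommGroup B] (red₀ : localPoints W (v.adicCompletion K) →+ B)
    (hstab : ∀ (σ : absoluteGaloisGroup (v.adicCompletion K)) (Q : localPoints W (v.adicCompletion K)),
      red₀ Q = 0 → red₀ (σ • Q) = 0)
    (hdiv₁ : ∀ a : localPoints W (v.adicCompletion K), red₀ a = 0 →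
      ∃ b : localPoints W (v.adicCompletion K), red₀ b = 0 ∧ p • b = a)
    (C : AddSubgroup (localPoints W (v.adicCompletion K)))
    (hC : ∀ a, a ∈ C ↔ red₀ a = 0 ∧ ∃ e : ℕ, p ^ e • a = 0)
    (ρ : ContinuousRep (absoluteGaloisGroup (v.adicCompletion K)) ℤ C)
    (hρ : ∀ (σ : absoluteGaloisGroup (v.adicCompletion K)) (c : C),
      ((ρ σ c : C) : localPoints W (v.adicCompletion K)) = σ • (c : localPoints W (v.adicCompletion K)))
    (hH2 : Subsingleton (continuousCohomology 2 (ρ.restrict (subgroupIncl (κE.layerSubgroup n))).toTopRep))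
    (hCG : ∀ ψ : contOneCocycles (discreteTopRep κE.kerSubgroup (localPoints W (v.adicCompletion K))),
      (∀ τ, red₀ (ψ.1 τ) = 0) →
        ∃ e : localPoints W (v.adicCompletion K), red₀ e = 0 ∧
          ∀ τ : κE.kerSubgroup, ψ.1 τ = (τ : absoluteGaloisGroup (v.adicCompletion K)) • e - e)
    (a : localPoints W (v.adicCompletion K)) (ha0 : red₀ a = 0) (ha : ∀ τ ∈ κE.kerSubgroup, τ • a = a) (k : ℕ) :
    ∃ (j : ℕ) (m R t : localPoints W (v.adicCompletion K)),
      (∀ τ ∈ κE.kerSubgroup, τ • m = m) ∧ (∀ τ ∈ κE.kerSubgroup, τ • R = R) ∧ (∃ e : ℕ, p ^ e • t = 0) ∧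
      p ^ j • a = ((g ^ p ^ n) • m - m) + p ^ (k + j) • R + t := by
  -- adapted from Summits/.../Theorems/PublishedInputsGreenbergLocalSurjectivityAtPCoinv.lean (gen 4, layer 0)
  -- notation and instances
  let E := v.adicCompletion K
  let Pt : Type u := localPoints W E
  let Γ := absoluteGaloisGroup E
  let N : Subgroup Γ := κE.kerSubgroup
  let Hn : Subgroup Γ := κE.layerSubgroup n
  let gn : Γ := g ^ p ^ n
  haveI : CompactSpace Γ := absoluteGaloisGroup_compactSpace E
  haveI : T2Space Γ := krullTopology_t2
  have hle : N ≤ Hn := κE.kerSubgroup_le_layerSubgroup n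
  have hgn : gn ∈ Hn := pow_mem_layerSubgroup κE hγ n
  let γn : Hn := ⟨gn, hgn⟩
  have hHo : IsOpen (Hn : Set Γ) := κE.isOpen_layerSubgroup n
  have hHc : IsClosed (Hn : Set Γ) := Subgroup.isClosed_of_isOpen _ hHo
  haveI : CompactSpace Hn := isCompact_iff_compactSpace.mp hHc.isCompact
  have galois_smul_nsmul : ∀ (τ : Γ) (n : ℕ) (P : Pt), τ • (n • P) = n • (τ • P) :=
    fun τ n P ↦ map_nsmul (DistribSMul.toAddMonoidHom Pt τ) n P
  have hprim : IsPrimaryTorsion p C := fun c ↦ by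
    obtain ⟨-, e, he⟩ := (hC c).mp c.2
    exact ⟨e, Subtype.ext (by rw [AddSubgroupClass.coe_nsmul, he, ZeroMemClass.coe_zero])⟩
  -- the quotient `κ_n : H_n ↠ ℤ_p` (brick 10), its kernel `N' = N` inside `H_n`
  obtain ⟨φn, hφsurj, -, hφker, hφγ⟩ := exists_layer_continuousMonoidHom κE hγ n
  let N' : Subgroup Hn := φn.toMonoidHom.ker
  have hmemN' : ∀ τ : Hn, τ ∈ N' ↔ (τ : Γ) ∈ N := fun τ ↦ by rw [MonoidHom.mem_ker]; exact (hφker τ).symm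
  haveI hN'c : IsClosed (N' : Set Hn) := by
    have e : (N' : Set Hn) = φn ⁻¹' {1} := by ext τ; exact MonoidHom.mem_ker
    rw [e]; exact isClosed_singleton.preimage φn.continuous
  let ρH : ContinuousRep Hn ℤ C := ρ.restrict (subgroupIncl Hn)
  -- iterated `p`-divisibility of `E₁`
  have hdivpow : ∀ (i : ℕ) (x : Pt), red₀ x = 0 → ∃ y : Pt, red₀ y = 0 ∧ p ^ i • y = x := by
    intro i
    induction i with
    | zero => exact fun x hx ↦ ⟨x, hx, by rw [pow_zero, one_smul]⟩
    | succ i ih =>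
      intro x hx
      obtain ⟨y, hy, rfl⟩ := hdiv₁ x hx
      obtain ⟨z, hz, rfl⟩ := ih y hy
      exact ⟨z, hz, by rw [pow_succ, mul_comm, mul_smul]⟩
  -- `b ∈ E₁` with `p^k b = a`; the Kummer cocycle `s(τ) = τ b − b` on `N'` with values in `C`
  obtain ⟨b, hb0, hba⟩ := hdivpow k a ha0
  have hsmem : ∀ τ : N', ((τ : Hn) : Γ) • b - b ∈ C := fun τ ↦ by
    refine (hC _).mpr ⟨?_, k, ?_⟩
    · rw [map_sub, hstab _ b hb0, hb0, sub_zero]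
    · rw [smul_sub, ← galois_smul_nsmul, hba, ha _ ((hmemN' τ).mp τ.2), sub_self]
  have hscont : Continuous fun τ : N' ↦ (⟨((τ : Hn) : Γ) • b - b, hsmem τ⟩ : C) :=
    ((continuous_of_discreteTopology (f := fun q : Pt ↦ q - b)).comp
      ((continuous_smul_localPoints W E b).comp (continuous_subtype_val.comp continuous_subtype_val))).subtype_mk _
  have hρN : ∀ (τ : N') (c : C),
      (((subgroupRep ρH.toTopRep N').ρ τ c : C) : Pt) = ((τ : Hn) : Γ) • (c : Pt) := fun τ c ↦ hρ ((τ : Hn) : Γ) c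
  let s : contOneCocycles (subgroupRep ρH.toTopRep N') :=
    ⟨⟨fun τ ↦ ⟨((τ : Hn) : Γ) • b - b, hsmem τ⟩, hscont⟩, fun σ τ ↦ by
      apply Subtype.ext
      rw [AddSubgroup.coe_add, hρN]
      change (((σ * τ : N') : Hn) : Γ) • b - b = (((σ : Hn) : Γ) • b - b) + ((σ : Hn) : Γ) • (((τ : Hn) : Γ) • b - b)
      rw [Subgroup.coe_mul, Subgroup.coe_mul, mul_smul, smul_sub]
      abel⟩
  have hs : ∀ τ : N', ((s.1 τ : C) : Pt) = ((τ : Hn) : Γ) • b - b := fun _ ↦ rfl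
  -- Hochschild–Serre on `H_n`: `[s] = g^{pⁿ}·[ψ] − [ψ]` in `H¹(N', C)`
  have hinj : ∀ x : continuousCohomology 2 ρH.toTopRep, resSubgroup ρH.toTopRep N' 2 x = 0 → x = 0 :=
    fun x _ ↦ Subsingleton.elim _ _
  have hcd : GroupCdLE (Hn ⧸ N') p 1 := groupCdLE_one_quotient_ker_of_surjective φn hφsurj
  obtain ⟨tc, htc⟩ := exists_conjMap_sub_eq_of_resSubgroup_two_injective φn N' ρH hφsurj
    (fun _ ↦ MonoidHom.mem_ker) hφγ hcd hprim hinj (oneCocycleClass _ s)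
  obtain ⟨ψ, rfl⟩ := oneCocycleClass_surjective _ tc
  rw [conjMap_oneCocycleClass, ← oneCocycleClass_sub, ← sub_eq_zero, ← oneCocycleClass_sub,
    oneCocycleClass_eq_zero_iff] at htc
  obtain ⟨c₀, hc₀⟩ := htc
  have hc₀' : ∀ τ : N',
      gn • (((ψ.1 (subgroupConj N' γn τ) : C) : Pt)) - ((ψ.1 τ : C) : Pt) - (((τ : Hn) : Γ) • b - b) =
        ((τ : Hn) : Γ) • (c₀ : Pt) - c₀ := by
    intro τ
    have h := congrArg (fun x : C ↦ (x : Pt)) (hc₀ τ)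
    simp only [ContinuousMap.sub_apply, AddSubgroupClass.coe_sub] at h
    rw [hρN, hs] at h
    rw [← hρ]
    exact h
  -- a uniform exponent killing `ψ` and `c₀`
  obtain ⟨Nψ, hNψ⟩ := exists_pow_smul_apply_eq_zero (p := p) ψ.1 (fun τ ↦ hprim _)
  obtain ⟨e₀, he₀⟩ := hprim c₀
  -- Coates–Greenberg: `ψ = ∂e` with `e ∈ E₁` (transport `ψ` to a cocycle on `N ≤ Γ`)
  let ι : κE.kerSubgroup → N' := fun τ ↦ ⟨⟨(τ : Γ), hle τ.2⟩, (hmemN' _).mpr τ.2⟩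
  have hιc : Continuous ι := (continuous_subtype_val.subtype_mk _).subtype_mk _
  let ψ' : contOneCocycles (discreteTopRep κE.kerSubgroup Pt) :=
    ⟨⟨fun τ ↦ ((ψ.1 (ι τ) : C) : Pt), continuous_subtype_val.comp (ψ.1.continuous.comp hιc)⟩, fun σ τ ↦ by
      change ((ψ.1 (ι (σ * τ)) : C) : Pt) = ((ψ.1 (ι σ) : C) : Pt) + (σ : Γ) • ((ψ.1 (ι τ) : C) : Pt)
      have hm : ι (σ * τ) = ι σ * ι τ := rfl
      rw [hm, ψ.2 (ι σ) (ι τ), AddSubgroup.coe_add, hρN]⟩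
  have hψ' : ∀ τ, ψ'.1 τ = ((ψ.1 (ι τ) : C) : Pt) := fun _ ↦ rfl
  obtain ⟨e, he0, he⟩ := hCG ψ' (fun τ ↦ ((hC _).mp (ψ.1 (ι τ)).2).1)
  have hψe : ∀ τ : N', ((ψ.1 τ : C) : Pt) = ((τ : Hn) : Γ) • e - e := fun τ ↦ by
    have h := he ⟨((τ : Hn) : Γ), (hmemN' τ).mp τ.2⟩
    rw [hψ'] at h
    exact h
  -- `R' = b + c₀ − (g^{pⁿ} e − e)` is fixed by `N`
  have hconj_smul : ∀ τ : N', gn • ((((subgroupConj N' γn τ : N') : Hn) : Γ) • e) = ((τ : Hn) : Γ) • gn • e := by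
    intro τ
    have hcoe : (((subgroupConj N' γn τ : N') : Hn) : Γ) = gn⁻¹ * ((τ : Hn) : Γ) * gn := by
      rw [subgroupConj_apply_coe]; rfl
    rw [hcoe, ← mul_smul, ← mul_smul, ← mul_assoc, ← mul_assoc, mul_inv_cancel, one_mul]
  have hR' : ∀ τ ∈ κE.kerSubgroup, τ • (b + (c₀ : Pt) - (gn • e - e)) = b + (c₀ : Pt) - (gn • e - e) := by
    intro τ hτ
    have h := hc₀' (ι ⟨τ, hτ⟩)
    rw [hψe, hψe, smul_sub gn, hconj_smul] at h
    change τ • gn • e - gn • e - (τ • e - e) - (τ • b - b) = τ • (c₀ : Pt) - c₀ at h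
    rw [← sub_eq_zero]
    rw [← sub_eq_zero] at h
    rw [smul_sub τ, smul_add τ, smul_sub τ]
    calc τ • b + τ • (c₀ : Pt) - (τ • gn • e - τ • e) - (b + (c₀ : Pt) - (gn • e - e))
        = -(τ • gn • e - gn • e - (τ • e - e) - (τ • b - b) - (τ • (c₀ : Pt) - c₀)) := by abel
      _ = 0 := by rw [h, neg_zero]
  -- `m = p^K e` is fixed by `N` for `K = k + (Nψ + e₀)`
  have hm : ∀ τ ∈ κE.kerSubgroup, τ • ((p ^ (k + (Nψ + e₀))) • e) = (p ^ (k + (Nψ + e₀))) • e := by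
    intro τ hτ
    have h1 : p ^ Nψ • (τ • e - e) = 0 := by
      have h := congrArg (fun x : C ↦ (x : Pt)) (hNψ (ι ⟨τ, hτ⟩))
      simp only [AddSubgroupClass.coe_nsmul, ZeroMemClass.coe_zero] at h
      rw [hψe] at h
      exact h
    rw [galois_smul_nsmul, ← sub_eq_zero, ← smul_sub, show k + (Nψ + e₀) = (k + e₀) + Nψ by ring, pow_add,
      mul_smul, h1, smul_zero]
  refine ⟨Nψ + e₀, (p ^ (k + (Nψ + e₀))) • e, b + (c₀ : Pt) - (gn • e - e), 0, hm, hR', ⟨0, smul_zero _⟩, ?_⟩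
  -- multiply `R'` by `p^(k + Nψ + e₀)`
  have h1 : p ^ (k + (Nψ + e₀)) • b = p ^ (Nψ + e₀) • a := by
    rw [pow_add, mul_comm, mul_smul, hba]
  have h2 : p ^ (k + (Nψ + e₀)) • (c₀ : Pt) = 0 := by
    rw [show k + (Nψ + e₀) = (k + Nψ) + e₀ by ring, pow_add, mul_smul, ← AddSubgroupClass.coe_nsmul, he₀,
      ZeroMemClass.coe_zero, smul_zero]
  rw [add_zero, smul_sub (p ^ (k + (Nψ + e₀))), smul_add (p ^ (k + (Nψ + e₀))), h1, h2, add_zero,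
    smul_sub (p ^ (k + (Nψ + e₀))), galois_smul_nsmul]
  abel

set_option maxHeartbeats 800000 in
/-- **`(E(K_{∞,η}) ⊗ ℚ_p/ℤ_p)_{Γ_{v_n}} = 0` at a good ordinary `v ∣ p`, element-wise, at the LAYER `n`** — for the
kernel `N` and a topological generator `g` of a `ℤ_p`-extension `κE` of `K_v`, the generator of the layer being `g^{pⁿ}`:
from the ordinary `red₀`-package (`hstab`, `hdiv₁`, `htor`), `H²(H_n, C) = 0` for `C = E₁ ∩ E(K̄_v)[p^∞]` (`hH2`, brick 9)
and the Coates–Greenberg vanishing on `N` (`hCG`): for every `N`-fixed `a` and every `k` there are `j`, `N`-fixed `m, R` and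
a `p`-power-torsion `t` with `p^j a = (g^{pⁿ} m − m) + p^{k+j} R + t`. Layer-`n` form of gen 4's
`coinvInput_of_formalH2_of_coatesGreenberg`. [cite: GreenbergLNM1716, §2 pp. 70–75 and §4 p. 108]
[cite: CoatesGreenberg1996, Cor. 3.2 and Prop. 4.3] -/
theorem coinvInput_layer_of_formalH2_of_coatesGreenberg (κE : ZpExtension (v.adicCompletion K) p)
    {g : absoluteGaloisGroup (v.adicCompletion K)} (hγ : κE.IsTopGenerator g) (n : ℕ)
    {B : Type*} [AddCommGroup B] (red₀ : localPoints W (v.adicCompletion K) →+ B)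
    (hstab : ∀ (σ : absoluteGaloisGroup (v.adicCompletion K)) (Q : localPoints W (v.adicCompletion K)),
      red₀ Q = 0 → red₀ (σ • Q) = 0)
    (hdiv₁ : ∀ a : localPoints W (v.adicCompletion K), red₀ a = 0 →
      ∃ b : localPoints W (v.adicCompletion K), red₀ b = 0 ∧ p • b = a)
    (htor : ∀ P : localPoints W (v.adicCompletion K), ∃ n : ℕ, 0 < n ∧ red₀ (n • P) = 0)
    (C : AddSubgroup (localPoints W (v.adicCompletion K)))
    (hC : ∀ a, a ∈ C ↔ red₀ a = 0 ∧ ∃ e : ℕ, p ^ e • a = 0)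
    (ρ : ContinuousRep (absoluteGaloisGroup (v.adicCompletion K)) ℤ C)
    (hρ : ∀ (σ : absoluteGaloisGroup (v.adicCompletion K)) (c : C),
      ((ρ σ c : C) : localPoints W (v.adicCompletion K)) = σ • (c : localPoints W (v.adicCompletion K)))
    (hH2 : Subsingleton (continuousCohomology 2 (ρ.restrict (subgroupIncl (κE.layerSubgroup n))).toTopRep))
    (hCG : ∀ ψ : contOneCocycles (discreteTopRep κE.kerSubgroup (localPoints W (v.adicCompletion K))),
      (∀ τ, red₀ (ψ.1 τ) = 0) →
        ∃ e : localPoints W (v.adicCompletion K), red₀ e = 0 ∧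
          ∀ τ : κE.kerSubgroup, ψ.1 τ = (τ : absoluteGaloisGroup (v.adicCompletion K)) • e - e)
    (a : localPoints W (v.adicCompletion K)) (ha : ∀ τ ∈ κE.kerSubgroup, τ • a = a) (k : ℕ) :
    ∃ (j : ℕ) (m R t : localPoints W (v.adicCompletion K)),
      (∀ τ ∈ κE.kerSubgroup, τ • m = m) ∧ (∀ τ ∈ κE.kerSubgroup, τ • R = R) ∧ (∃ e : ℕ, p ^ e • t = 0) ∧
      p ^ j • a = ((g ^ p ^ n) • m - m) + p ^ (k + j) • R + t := by
  have galois_smul_nsmul : ∀ (τ : absoluteGaloisGroup (v.adicCompletion K)) (n : ℕ)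
      (P : localPoints W (v.adicCompletion K)), τ • (n • P) = n • (τ • P) :=
    fun τ n P ↦ map_nsmul (DistribSMul.toAddMonoidHom (localPoints W (v.adicCompletion K)) τ) n P
  -- a positive multiple `n a ∈ E₁`, `n = p^s u` with `p ∤ u`
  obtain ⟨n₀, hn, hna⟩ := htor a
  obtain ⟨s, u, hu, rfl⟩ := Nat.exists_eq_pow_mul_and_not_dvd hn.ne' p hp.out.ne_one
  rw [mul_comm, mul_smul] at hna
  have hfix : ∀ τ ∈ κE.kerSubgroup, τ • (u • (p ^ s • a)) = u • (p ^ s • a) := fun τ hτ ↦ by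
    rw [galois_smul_nsmul, galois_smul_nsmul, ha τ hτ]
  -- the core for `u • (p^s • a)` at depth `k + s`, then gen 4's bookkeeping
  have hcore := coinvInput_layer_of_mem_ker v W κE hγ n red₀ hstab hdiv₁ C hC ρ hρ hH2 hCG (u • (p ^ s • a)) hna hfix
    (k + s)
  exact coinvInput_of_pow_nsmul v W κE.kerSubgroup (g ^ p ^ n) a k s
    (coinvInput_of_nsmul_not_dvd v W κE.kerSubgroup (g ^ p ^ n) (p ^ s • a) (k + s) hu hcore
      (fun τ hτ ↦ by rw [galois_smul_nsmul, ha τ hτ]))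

end Summit.BirchSwinnertonDyer.BirchSwinnertonDyer.Theorems.InputsGreenbergLemma34Layer

end
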